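import Literature.NumberTheory.Weil1964.ThetaLift
import Literature.NumberTheory.Weil1964.ThetaDualPairDatum
import Literature.MeasureTheory.Group.CosetSpaceLpTransport
import HarnessLib

/-!
# Transport of theta kernels and theta lifts between two theta-kernel data related along group
# homomorphisms and a scalar twist (Weil 1964 n° 41; Gelbart–Rogawski 1991 §3.1 Remark; Howe 1979 §3)

Topic `NumberTheory/Weil1964`; namespace `Literature.NumberTheory.Weil1964.ThetaKernelDatum` (continues
`ThetaKernelDualPair`, `ThetaLift`, `ThetaDualPairDatum`).  KERNEL ONLY: theorems proved from the fields of the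
hypothesis structure `ThetaKernelDatum`; no `def`, no named fact, nothing of print asserted.

THE SITUATION.  One dual pair is frequently realised twice: once on «official» carriers
(`(GU, ΓU, G, Γ)`, Weil representation `ω`, theta-kernel datum `M`) and once on isomorphic model carriers
(`(GU′, ΓU′, G′, Γ′)`, representation `ω′`, datum `M′`) — two subgroups of `GL_n(𝔸)` identified by a change
of frame, the norm-one idèles versus the adelic points of the unitary group of a hermitian line, a see-saw
restriction of a bigger Weil representation versus the small pair's own one.  In all these cases the two
Weil ACTIONS on the common Schwartz–Bruhat space `S(X_A)` agree along group homomorphisms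
`φU : GU′ → GU`, `φ : G′ → G` up to a scalar character — [Howe1979, §3], [GelbartRogawski1991, §3.1 Remark
p. 457 L4–13]: «two splittings over a unitary dual pair differ by a character; the theta kernel changes by that
character» — so that the descended theta KERNELS satisfy, on the compact quotients,

  `θ′_Φ(ξ′, q′) = c₁(ξ′) · c₂(q′) · θ_Φ(b ξ′, a q′)`                                    (K)

for the induced maps `b : [GU′] → [GU]`, `a : [G′] → [G]` and two scalar functions `c₁`, `c₂` (the descended
character).  This file proves, from (K) alone:

* §1 (K) from its representative-level form `Θ′_Φ(s′(x′,y′)⁻¹) = k₁(x′) k₂(y′) Θ_Φ(s(φU x′, φ y′)⁻¹)`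
  (`thetaKer_rel_of_thetaFun_rel`), and that form for two `adelicOfDualPairRep` data whose representations
  satisfy `ω′(p′) = c(p′) • ω(ψ p′)` (`adelicOfDualPairRep_thetaFun_rel`);
* §2 **TRANSPORT OF THE LIFT** (`thetaLift_apply_of_thetaKer_rel`): for test functions matched by
  `c₂ · f′ = f ∘ a`,
  `Θ′_Φ(f′)(ξ′) = c₁(ξ′) · Θ_Φ(f)(b ξ′)`, the lift `Θ_Φ` being taken against the PUSH-FORWARD measure `a_* μ′`
  ([FleigEtAl2018, (12.37)] for both data; change of variables `∫ g d(a_*μ′) = ∫ g ∘ a dμ′`);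
* §3 **TRANSPORT OF NON-VANISHING** in both directions (`thetaLift_ne_zero_of_thetaKer_rel`,
  `thetaLift_ne_zero_of_thetaKer_rel'`): with `c₁` nowhere zero and `b` onto, `Θ_Φ(f) ≠ 0 ↔ Θ′_Φ(f′) ≠ 0`;
* §4 the case of GROUP ISOMORPHISMS `eU : GU′ ≃* GU`, `e : G′ ≃* G` matching the arithmetic subgroups: then
  `a`, `b` are the tree's coset-space congruences `cosetCongr` (`MeasureTheory/Group/InvariantQuotientTransport`,
  `…/CosetSpaceLpTransport`: homeomorphisms; push-forwards of invariant / finite / open-positive measures stay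
  such), `b` is onto, and the matched test function is `f = (c₂ · f′) ∘ a⁻¹` (`thetaLift_cosetCongr_apply`,
  `thetaLift_ne_zero_iff_of_cosetCongr`).

USE (Hodge-CM cell, programme P4 «admissible occurs in H¹», seat J-R): Rallis' inner product formula
[Li1992, Thm 2.1] is typed over `UnitaryDualPair.thetaKernelDatum` (carriers `UnitaryGroup.adelic …`), while
the model's theta distributions lift through `WeilPairData.kernelDatum` (carriers `regimeSubgroup × relNormOneIdeles`);
both are `adelicOfDualPairRep` data over the same `𝒮(𝔸³)`, related as above (`cmLineRepFin₀_apply_eq_smul_cmPairRep`),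
and §3 carries the non-vanishing of theta lifts from one to the other.  Nothing here is specific to that use.

## Mathlib / tree search
Tree: `ThetaLift` §7 `seesaw_identity` / `thetaKer_seesaw_mk` (kernels of two data compared along maps — the
pattern followed here), `thetaLift_of_theta_eq_mul` (scalar change of `Φ`), `ThetaDualPairDatum`
(`adelicOfDualPairRep_thetaFun_mk`), `MeasureTheory/Group/CosetSpaceLpTransport` (`cosetCongr*`,
`smulInvariantMeasure_map_cosetCongr_of_smulInvariantMeasure`, `isOpenPosMeasure_map_cosetCongr`).
Mathlib: `MeasureTheory.integral_map`, `integral_const_mul`, `QuotientGroup.induction_on`, `DFunLike.ne_iff`.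
No transport-of-lift statement existed (`lean search 'thetaLift.*(transport|congr|comp)'`: only `thetaLift_congr`,
equality of `Φ`'s).

## References
* [Weil1964] A. Weil, Acta Math. 111 (1964) 143–211, Chap. III n° 41 Thm 6 p. 193 (`Θ_{S′Φ}(S) = Θ_Φ(SS′)`).
* [Howe1979] R. Howe, *θ-series and invariant theory*, Proc. Sympos. Pure Math. 33.1 (1979), §3.
* [GelbartRogawski1991] S. Gelbart, J. Rogawski, Invent. Math. 105 (1991), §3.1 Remark p. 457 L4–13.
* [FleigEtAl2018] P. Fleig, H. Gustafsson, A. Kleinschmidt, D. Persson, CUP (2018), §12.3 Def. 12.5 (12.37).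
* [Li1992] J.-S. Li, J. reine angew. Math. 428 (1992), Thm 2.1 p. 184 (the consumer).
-/

set_option autoImplicit false

noncomputable section

open _root_.MeasureTheory Set Filter Function
open Literature.MeasureTheory.Group

namespace Literature.NumberTheory.Weil1964

namespace ThetaKernelDatum

universe u v u'

variable {Mp : Type u} {SX : Type v} [TopologicalSpace Mp] [Group Mp] [TopologicalSpace SX]
variable {GU : Type*} [Group GU] [TopologicalSpace GU] [IsTopologicalGroup GU] {ΓU : Subgroup GU}
variable {G : Type*} [Group G] [TopologicalSpace G] [IsTopologicalGroup G] {Γ : Subgroup G}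
variable {Mp' : Type u'} [TopologicalSpace Mp'] [Group Mp']
variable {GU' : Type*} [Group GU'] [TopologicalSpace GU'] [IsTopologicalGroup GU'] {ΓU' : Subgroup GU'}
variable {G' : Type*} [Group G'] [TopologicalSpace G'] [IsTopologicalGroup G'] {Γ' : Subgroup G'}
variable (M : ThetaKernelDatum Mp SX GU ΓU G Γ) (M' : ThetaKernelDatum Mp' SX GU' ΓU' G' Γ')

/-! ## 1. The kernel relation (K) from its representative-level form -/

/-- **(K) on representatives ⇒ (K) on the quotients.**  If the theta functions of the two data agree along
`φU`, `φ` up to the multipliers `k₁`, `k₂` — `Θ′_Φ(s′(x′,y′)⁻¹) = k₁(x′) k₂(y′) Θ_Φ(s(φU x′, φ y′)⁻¹)` — and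
`a`, `b`, `c₁`, `c₂` are the maps / functions they induce on the quotients (given as data with their values on
representatives), then `θ′_Φ(ξ′, q′) = c₁(ξ′) c₂(q′) θ_Φ(b ξ′, a q′)`.
[cite: GelbartRogawski1991, §3.1 Remark p. 457 L4–13] -/
theorem thetaKer_rel_of_thetaFun_rel {φU : GU' → GU} {φ : G' → G} {k₁ : GU' → ℂ} {k₂ : G' → ℂ}
    (hθ : ∀ (Φ : SX) (x' : GU') (y' : G'),
      M'.thetaFun Φ (x', y') = k₁ x' * k₂ y' * M.thetaFun Φ (φU x', φ y'))
    {a : G' ⧸ Γ' → G ⧸ Γ} {b : GU' ⧸ ΓU' → GU ⧸ ΓU} {c₁ : GU' ⧸ ΓU' → ℂ} {c₂ : G' ⧸ Γ' → ℂ}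
    (ha : ∀ y' : G', a (QuotientGroup.mk y') = QuotientGroup.mk (φ y'))
    (hb : ∀ x' : GU', b (QuotientGroup.mk x') = QuotientGroup.mk (φU x'))
    (hc₁ : ∀ x' : GU', c₁ (QuotientGroup.mk x') = k₁ x') (hc₂ : ∀ y' : G', c₂ (QuotientGroup.mk y') = k₂ y')
    (Φ : SX) (ξ' : GU' ⧸ ΓU') (q' : G' ⧸ Γ') :
    M'.thetaKer Φ (ξ', q') = c₁ ξ' * c₂ q' * M.thetaKer Φ (b ξ', a q') := by
  induction ξ' using QuotientGroup.induction_on with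
  | H x' =>
    induction q' using QuotientGroup.induction_on with
    | H y' =>
      rw [hb, ha, hc₁, hc₂, thetaKer_apply, thetaKer_apply, thetaQuot_mk, thetaQuot_mk, hθ]

/-! ### The representative-level form for two `adelicOfDualPairRep` data related by `ω′ = c • (ω ∘ ψ)` -/

section Adelic

open NumberField Literature.NumberTheory.Automorphic

variable {F : Type} [Field F] [NumberField F] {ι : Type} [Fintype ι]
variable [LocallyCompactSpace GU] [LocallyCompactSpace G] [LocallyCompactSpace GU'] [LocallyCompactSpace G']

/-- **Two linearised Weil representations of «the same» pair that differ by a character along a homomorphism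
of the pair groups have proportional adelic theta kernels**: if `ω′(p′) Φ = c(p′) • ω(ψ p′) Φ` then
`θ′_Φ(p′) = c(p′)⁻¹ · θ_Φ(ψ p′)` (`θ_Φ(x,h) = Θ(ω(x⁻¹,h⁻¹)Φ)`, `Θ` linear).
[cite: Howe1979, §3; GelbartRogawski1991, §3.1 Remark p. 457 L4–13] -/
theorem adelicOfDualPairRep_thetaFun_rel
    (ω : Representation ℂ (GU × G) (piSchwartzBruhat F ι)) (hω : HasThetaMajorants fun g Φ => ω g Φ)
    (hrat : ∀ γU ∈ ΓU, ∀ γ ∈ Γ, ω.toHomUnits (γU, γ) ∈ thetaStabilizer F ι)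
    (SK : Set (piSchwartzBruhat F ι)) (hSK : ∀ (h : G) (Φ : piSchwartzBruhat F ι), Φ ∈ SK → ω (1, h) Φ ∈ SK)
    (ω' : Representation ℂ (GU' × G') (piSchwartzBruhat F ι)) (hω' : HasThetaMajorants fun g Φ => ω' g Φ)
    (hrat' : ∀ γU ∈ ΓU', ∀ γ ∈ Γ', ω'.toHomUnits (γU, γ) ∈ thetaStabilizer F ι)
    (SK' : Set (piSchwartzBruhat F ι)) (hSK' : ∀ (h : G') (Φ : piSchwartzBruhat F ι), Φ ∈ SK' → ω' (1, h) Φ ∈ SK')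
    (ψ : GU' × G' →* GU × G) (c : GU' × G' →* ℂˣ)
    (hωω' : ∀ (p' : GU' × G') (Φ : piSchwartzBruhat F ι), ω' p' Φ = ((c p' : ℂˣ) : ℂ) • ω (ψ p') Φ)
    (Φ : piSchwartzBruhat F ι) (p' : GU' × G') :
    (adelicOfDualPairRep (ΓU := ΓU') (Γ := Γ') ω' hω' hrat' SK' hSK').thetaFun Φ p' =
      (((c p')⁻¹ : ℂˣ) : ℂ) * (adelicOfDualPairRep (ΓU := ΓU) (Γ := Γ) ω hω hrat SK hSK).thetaFun Φ (ψ p') := by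
  obtain ⟨x', y'⟩ := p'
  have hψ : ψ (x', y')⁻¹ = (ψ (x', y'))⁻¹ := map_inv ψ _
  rw [adelicOfDualPairRep_thetaFun_mk, ← Prod.inv_mk, hωω', map_smul, map_inv, smul_eq_mul]
  congr 1
  rw [thetaFun_apply, adelicOfDualPairRep_s, MonoidHom.id_apply, ← hψ]
  rfl

end Adelic

/-! ## 2. Transport of the lift -/

section Lift

variable [CompactSpace (GU ⧸ ΓU)] [CompactSpace (G ⧸ Γ)] [MeasurableSpace (G ⧸ Γ)] [BorelSpace (G ⧸ Γ)]
variable [CompactSpace (GU' ⧸ ΓU')] [CompactSpace (G' ⧸ Γ')] [MeasurableSpace (G' ⧸ Γ')] [BorelSpace (G' ⧸ Γ')]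
  (μ' : Measure (G' ⧸ Γ')) [IsFiniteMeasure μ']

/-- **TRANSPORT OF THE THETA LIFT.**  Under the kernel relation (K)
`θ′_Φ(ξ′, q′) = c₁(ξ′) c₂(q′) θ_Φ(b ξ′, a q′)` with `a` continuous, and for test functions matched by
`c₂(q′) f′(q′) = f(a q′)`, the lift of the primed datum against `μ′` is the lift of the unprimed datum against
the push-forward `a_* μ′`, read back along `b` and multiplied by `c₁`:
`Θ′_Φ(f′)(ξ′) = c₁(ξ′) · Θ_Φ(f)(b ξ′)`.  (Both lifts are `∫ θ(·, q) f(q) dμ(q)`, [FleigEtAl2018, (12.37)];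
the proof is the change of variables `∫ g d(a_*μ′) = ∫ g ∘ a dμ′`.)
[cite: FleigEtAl2018, §12.3 Definition 12.5 (12.37); GelbartRogawski1991, §3.1 Remark p. 457 L4–13] -/
theorem thetaLift_apply_of_thetaKer_rel (a : C(G' ⧸ Γ', G ⧸ Γ)) (b : GU' ⧸ ΓU' → GU ⧸ ΓU)
    (c₁ : GU' ⧸ ΓU' → ℂ) (c₂ : G' ⧸ Γ' → ℂ)
    (hker : ∀ (Φ : SX) (ξ' : GU' ⧸ ΓU') (q' : G' ⧸ Γ'),
      M'.thetaKer Φ (ξ', q') = c₁ ξ' * c₂ q' * M.thetaKer Φ (b ξ', a q'))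
    (Φ : SX) {f : C(G ⧸ Γ, ℂ)} {f' : C(G' ⧸ Γ', ℂ)} (hf : ∀ q' : G' ⧸ Γ', c₂ q' * f' q' = f (a q'))
    (ξ' : GU' ⧸ ΓU') :
    M'.thetaLift μ' Φ f' ξ' = c₁ ξ' * M.thetaLift (μ'.map a) Φ f (b ξ') := by
  haveI : IsFiniteMeasure (μ'.map a) := Measure.isFiniteMeasure_map μ' a
  have hcont : Continuous fun q : G ⧸ Γ => M.thetaKer Φ (b ξ', q) * f q :=
    ((M.thetaKer Φ).continuous.comp (Continuous.prodMk_right (b ξ'))).mul f.continuous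
  rw [thetaLift_apply, thetaLift_apply,
    integral_map a.continuous.measurable.aemeasurable hcont.aestronglyMeasurable, ← integral_const_mul]
  refine integral_congr_ae (Eventually.of_forall fun q' => ?_)
  simp only
  rw [hker, ← hf]
  ring

/-- The same as an identity of continuous functions when `b` is (the underlying map of) a continuous map and
`c₁` is continuous: `Θ′_Φ(f′) = c₁ · (Θ_Φ(f) ∘ b)`. [cite: FleigEtAl2018, §12.3 Definition 12.5 (12.37)] -/
theorem thetaLift_eq_of_thetaKer_rel (a : C(G' ⧸ Γ', G ⧸ Γ)) (b : C(GU' ⧸ ΓU', GU ⧸ ΓU))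
    (c₁ : C(GU' ⧸ ΓU', ℂ)) (c₂ : G' ⧸ Γ' → ℂ)
    (hker : ∀ (Φ : SX) (ξ' : GU' ⧸ ΓU') (q' : G' ⧸ Γ'),
      M'.thetaKer Φ (ξ', q') = c₁ ξ' * c₂ q' * M.thetaKer Φ (b ξ', a q'))
    (Φ : SX) {f : C(G ⧸ Γ, ℂ)} {f' : C(G' ⧸ Γ', ℂ)} (hf : ∀ q' : G' ⧸ Γ', c₂ q' * f' q' = f (a q')) :
    M'.thetaLift μ' Φ f' = c₁ * (M.thetaLift (μ'.map a) Φ f).comp b := by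
  ext ξ'
  rw [M.thetaLift_apply_of_thetaKer_rel M' μ' a b c₁ c₂ hker Φ hf ξ']
  rfl

/-! ## 3. Transport of non-vanishing -/

/-- **NON-VANISHING GOES UP**: under (K) with `c₁` nowhere zero and `b` onto, if the lift of the unprimed datum
(against `a_* μ′`) is not the zero function then neither is the lift of the primed datum.
[cite: Li1992, p. 178 («θ^f_φ is non-zero iff …»); FleigEtAl2018, §12.3 (12.37)] -/
theorem thetaLift_ne_zero_of_thetaKer_rel (a : C(G' ⧸ Γ', G ⧸ Γ)) (b : GU' ⧸ ΓU' → GU ⧸ ΓU)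
    (c₁ : GU' ⧸ ΓU' → ℂ) (c₂ : G' ⧸ Γ' → ℂ)
    (hker : ∀ (Φ : SX) (ξ' : GU' ⧸ ΓU') (q' : G' ⧸ Γ'),
      M'.thetaKer Φ (ξ', q') = c₁ ξ' * c₂ q' * M.thetaKer Φ (b ξ', a q'))
    (hc₁ : ∀ ξ', c₁ ξ' ≠ 0) (hb : Function.Surjective b)
    (Φ : SX) {f : C(G ⧸ Γ, ℂ)} {f' : C(G' ⧸ Γ', ℂ)} (hf : ∀ q' : G' ⧸ Γ', c₂ q' * f' q' = f (a q'))
    (h : M.thetaLift (μ'.map a) Φ f ≠ 0) : M'.thetaLift μ' Φ f' ≠ 0 := by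
  obtain ⟨ξ, hξ⟩ := DFunLike.ne_iff.mp h
  obtain ⟨ξ', rfl⟩ := hb ξ
  refine DFunLike.ne_iff.mpr ⟨ξ', ?_⟩
  rw [M.thetaLift_apply_of_thetaKer_rel M' μ' a b c₁ c₂ hker Φ hf ξ', ContinuousMap.zero_apply]
  exact mul_ne_zero (hc₁ ξ') hξ

/-- **NON-VANISHING GOES DOWN**: under (K), if the lift of the primed datum is not the zero function then
neither is the lift of the unprimed datum against `a_* μ′` (no hypothesis on `c₁`, `b`).
[cite: Li1992, p. 178; FleigEtAl2018, §12.3 (12.37)] -/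
theorem thetaLift_ne_zero_of_thetaKer_rel' (a : C(G' ⧸ Γ', G ⧸ Γ)) (b : GU' ⧸ ΓU' → GU ⧸ ΓU)
    (c₁ : GU' ⧸ ΓU' → ℂ) (c₂ : G' ⧸ Γ' → ℂ)
    (hker : ∀ (Φ : SX) (ξ' : GU' ⧸ ΓU') (q' : G' ⧸ Γ'),
      M'.thetaKer Φ (ξ', q') = c₁ ξ' * c₂ q' * M.thetaKer Φ (b ξ', a q'))
    (Φ : SX) {f : C(G ⧸ Γ, ℂ)} {f' : C(G' ⧸ Γ', ℂ)} (hf : ∀ q' : G' ⧸ Γ', c₂ q' * f' q' = f (a q'))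
    (h : M'.thetaLift μ' Φ f' ≠ 0) : M.thetaLift (μ'.map a) Φ f ≠ 0 := by
  obtain ⟨ξ', hξ'⟩ := DFunLike.ne_iff.mp h
  refine DFunLike.ne_iff.mpr ⟨b ξ', fun h0 => hξ' ?_⟩
  rw [M.thetaLift_apply_of_thetaKer_rel M' μ' a b c₁ c₂ hker Φ hf ξ', h0]
  simp only [ContinuousMap.zero_apply, mul_zero]

end Lift

/-! ## 4. Along group isomorphisms: `a`, `b` are coset-space congruences -/

section Iso

variable (eU : GU' ≃* GU) (hU : ∀ x', eU x' ∈ ΓU ↔ x' ∈ ΓU') (e : G' ≃* G) (hΓ : ∀ y', e y' ∈ Γ ↔ y' ∈ Γ')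

omit [IsTopologicalGroup G] [IsTopologicalGroup G'] in
/-- **The matched test function along an isomorphism**: for `a = cosetCongr e` (a bijection of the coset
spaces) and any continuous `c₂`, the function `f := (c₂ · f′) ∘ a⁻¹` satisfies `c₂ · f′ = f ∘ a`.
[cite: GelbartRogawski1991, §3.1 Remark p. 457 L4–13] -/
theorem cosetCongr_match (hes : Continuous e.symm) (c₂ : C(G' ⧸ Γ', ℂ)) (f' : C(G' ⧸ Γ', ℂ))
    (q' : G' ⧸ Γ') :
    c₂ q' * f' q' =
      ((c₂ * f').comp
          ⟨cosetCongr e.symm Γ Γ' (forall_symm_mem_iff e Γ' Γ hΓ),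
            continuous_cosetCongr e.symm Γ Γ' (forall_symm_mem_iff e Γ' Γ hΓ) hes⟩)
        (cosetCongr e Γ' Γ hΓ q') := by
  simp only [ContinuousMap.comp_apply, ContinuousMap.coe_mk, cosetCongr_symm_apply, ContinuousMap.mul_apply]

variable [CompactSpace (GU ⧸ ΓU)] [CompactSpace (G ⧸ Γ)] [MeasurableSpace (G ⧸ Γ)] [BorelSpace (G ⧸ Γ)]
variable [CompactSpace (GU' ⧸ ΓU')] [CompactSpace (G' ⧸ Γ')] [MeasurableSpace (G' ⧸ Γ')] [BorelSpace (G' ⧸ Γ')]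
  (μ' : Measure (G' ⧸ Γ')) [IsFiniteMeasure μ']

/-- **TRANSPORT OF THE LIFT ALONG ISOMORPHISMS.**  If `Θ′_Φ(s′(x′,y′)⁻¹) = k₁(x′) k₂(y′) Θ_Φ(s(eU x′, e y′)⁻¹)`
for group isomorphisms `eU`, `e` matching the arithmetic subgroups, with `k₁`, `k₂` descending to `c₁`, `c₂`
on the quotients, then for every `f′`
`Θ′_Φ(f′)(ξ′) = c₁(ξ′) · Θ_Φ((c₂ f′) ∘ a⁻¹)(b ξ′)`, `a = cosetCongr e`, `b = cosetCongr eU`, the unprimed lift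
against `a_* μ′`. [cite: FleigEtAl2018, §12.3 Definition 12.5 (12.37); GelbartRogawski1991, §3.1 Remark p. 457 L4–13] -/
theorem thetaLift_cosetCongr_apply (he : Continuous e) (hes : Continuous e.symm) {k₁ : GU' → ℂ} {k₂ : G' → ℂ}
    (hθ : ∀ (Φ : SX) (x' : GU') (y' : G'),
      M'.thetaFun Φ (x', y') = k₁ x' * k₂ y' * M.thetaFun Φ (eU x', e y'))
    (c₁ : GU' ⧸ ΓU' → ℂ) (hc₁ : ∀ x' : GU', c₁ (QuotientGroup.mk x') = k₁ x')
    (c₂ : C(G' ⧸ Γ', ℂ)) (hc₂ : ∀ y' : G', c₂ (QuotientGroup.mk y') = k₂ y')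
    (Φ : SX) (f' : C(G' ⧸ Γ', ℂ)) (ξ' : GU' ⧸ ΓU') :
    M'.thetaLift μ' Φ f' ξ' =
      c₁ ξ' * M.thetaLift (μ'.map (cosetCongr e Γ' Γ hΓ)) Φ
        ((c₂ * f').comp
          ⟨cosetCongr e.symm Γ Γ' (forall_symm_mem_iff e Γ' Γ hΓ),
            continuous_cosetCongr e.symm Γ Γ' (forall_symm_mem_iff e Γ' Γ hΓ) hes⟩)
        (cosetCongr eU ΓU' ΓU hU ξ') :=
  M.thetaLift_apply_of_thetaKer_rel M' μ'
    ⟨cosetCongr e Γ' Γ hΓ, continuous_cosetCongr e Γ' Γ hΓ he⟩ (cosetCongr eU ΓU' ΓU hU) c₁ c₂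
    (M.thetaKer_rel_of_thetaFun_rel M' hθ (fun _ => rfl) (fun _ => rfl) hc₁ hc₂) Φ
    (fun q' => cosetCongr_match (Γ := Γ) (Γ' := Γ') e hΓ hes c₂ f' q') ξ'

include hU in
/-- **NON-VANISHING IS EQUIVALENT ALONG ISOMORPHISMS** when the multiplier `k₁` is nowhere zero:
`Θ′_Φ(f′) ≠ 0 ↔ Θ_Φ((c₂ f′) ∘ a⁻¹) ≠ 0` (the unprimed lift against `a_* μ′`).
[cite: Li1992, p. 178; GelbartRogawski1991, §3.1 Remark p. 457 L4–13] -/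
theorem thetaLift_ne_zero_iff_of_cosetCongr (he : Continuous e) (hes : Continuous e.symm) {k₁ : GU' → ℂ} {k₂ : G' → ℂ}
    (hθ : ∀ (Φ : SX) (x' : GU') (y' : G'),
      M'.thetaFun Φ (x', y') = k₁ x' * k₂ y' * M.thetaFun Φ (eU x', e y'))
    (hk₁ : ∀ x', k₁ x' ≠ 0)
    (c₁ : GU' ⧸ ΓU' → ℂ) (hc₁ : ∀ x' : GU', c₁ (QuotientGroup.mk x') = k₁ x')
    (c₂ : C(G' ⧸ Γ', ℂ)) (hc₂ : ∀ y' : G', c₂ (QuotientGroup.mk y') = k₂ y')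
    (Φ : SX) (f' : C(G' ⧸ Γ', ℂ)) :
    M'.thetaLift μ' Φ f' ≠ 0 ↔
      M.thetaLift (μ'.map (cosetCongr e Γ' Γ hΓ)) Φ
        ((c₂ * f').comp
          ⟨cosetCongr e.symm Γ Γ' (forall_symm_mem_iff e Γ' Γ hΓ),
            continuous_cosetCongr e.symm Γ Γ' (forall_symm_mem_iff e Γ' Γ hΓ) hes⟩) ≠ 0 := by
  have hker := M.thetaKer_rel_of_thetaFun_rel M' hθ
    (a := cosetCongr e Γ' Γ hΓ) (b := cosetCongr eU ΓU' ΓU hU) (fun _ => rfl) (fun _ => rfl) hc₁ hc₂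
  have hc₁' : ∀ ξ', c₁ ξ' ≠ 0 := fun ξ' => by
    induction ξ' using QuotientGroup.induction_on with
    | H x' => rw [hc₁]; exact hk₁ x'
  refine ⟨fun h => ?_, fun h => ?_⟩
  · exact M.thetaLift_ne_zero_of_thetaKer_rel' M' μ' ⟨_, continuous_cosetCongr e Γ' Γ hΓ he⟩ _ c₁ c₂ hker Φ
      (fun q' => cosetCongr_match (Γ := Γ) (Γ' := Γ') e hΓ hes c₂ f' q') h
  · exact M.thetaLift_ne_zero_of_thetaKer_rel M' μ' ⟨_, continuous_cosetCongr e Γ' Γ hΓ he⟩ _ c₁ c₂ hker hc₁'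
      (cosetCongrEquiv eU ΓU' ΓU hU).surjective Φ
      (fun q' => cosetCongr_match (Γ := Γ) (Γ' := Γ') e hΓ hes c₂ f' q') h

end Iso

end ThetaKernelDatum

end Literature.NumberTheory.Weil1964
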